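import Summits.HodgeConjecture.HodgeConjecture.Theorems.F0P3cStCharTSEllField          -- ★ p851227 «ELL-FIELD★» (S2): `splitNotEll`, `hyperbolicSet` glue
import Summits.HodgeConjecture.HodgeConjecture.Theorems.F0P3cStCharTSWeylHypMeasure     -- ★ (LH2-p02) `isRegularElt_glDiagonal_of_isUnit_sub` (unit differences ⇒ regular)
import Literature.NumberTheory.Automorphic.CMTorusRegularAEPairwise                      -- ★ `ae_isUnit_torusEntry_sub_three` (Haar-a.e. regularity on `M`)
import Summits.HodgeConjecture.HodgeConjecture.Theorems.F0P3cStCharTSShellWeight         -- ★ one-place bookkeeping `normAbs_le_normAbs_iff_valued` (brings the local-field instances of `L_w`)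
import Literature.NumberTheory.Automorphic.LocalFieldHaarBalls                            -- ★ `LocalFieldHaar.continuous_normAbs`
import Literature.NumberTheory.Automorphic.StableCentralizerEquivCM                       -- ★ `commute_of_commute_of_isRegularElt_local` (the centraliser of a regular element is abelian)
import Literature.NumberTheory.Rogawski1990.Ch12Sec5Inputs                               -- ★ the (S-𝔇) sockets (C1) (C2) (C3)
import HarnessLib

/-!
# F0 · P3c · line LH6 «StCharTS» — «CARTAN-FIELDS★» (datum road S9a, hypothesis form): the sockets (C1) `EllCartanSubset`, (C3) `NonEllCartanAE` and
# (C2) `EllCartanAE` of (S-𝔇) at any datum whose Cartan representatives are «the elliptic ones, filtered, plus the split torus `M`» [Rogawski1990, §12.5 pp. 182–184; §3.6]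

Cell `pub/hodgecm-mathlib`, crux H413 = `stmt-HodgeConjecture-24833` (lane `--supports …`), route HCCMUnconditional; seat LH6-p01 (g4) (slice-map owner).
THEOREMS ONLY (no definition ∕ instance ∕ notation ∕ named fact ∕ `sorry`); ★-only imports.  PLAN: `F0/P3b/LH6-p01/g4/PLAN-S9-CartanWeylMeasures.v1.LH6p01g4.md`.

WHAT.  The Weyl-integration bookkeeping of the (S-𝔇) organ `stub_EllipticPackage` (`Cruxes/H413/Lines/F0_P3c_StCharTSPaydown.lean`) carries three sockets on
the Cartan representatives of the §12.5 datum: (C1) `𝔇.cartanG ⊆ 𝔇.cartanAll` («one choice of representatives serves both p. 182 and p. 184»), (C3) «on a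
NON-elliptic representative a.e. `γ` is regular and not elliptic», (C2) «on an ELLIPTIC representative a.e. `γ` is elliptic regular».  For the quasi-split
`U(3)` (`F`-rank one) the constructor will take `cartanAll := {M} ∪ cartanG` with `M` the diagonal torus (every non-compact Cartan subgroup contains a split torus,
whose centraliser is a conjugate of the Levi `M`, §3.6) and `cartanG :=` the COMPACT (= elliptic, the centre being compact) representatives, `μT M` a Haar measure
on `M` (the canonical normalisation of ★ `OrbitalMeasureFamily.IsCanonical`), `ellG := G^r ∖ Ω`, `regG := G^r` (COMPAT).  Under these field HYPOTHESES (road rule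
§2.1: stated as equations on an abstract `𝔇`, discharged by `rfl` at the constructor) this file proves:
* §1 (C1) `ellCartanSubset_of_filter` — `cartanG = cartanAll.filter p` ⇒ `EllCartanSubset`;
* §2 (C3) `nonEllCartanAE_of_split` — the ONLY non-elliptic representative is `M` and `μT M` is a Haar measure ⇒ `NonEllCartanAE`: Haar-a.e. `t ∈ M` has pairwise unit
  differences of diagonal entries (★ `ae_isUnit_torusEntry_sub_three`), hence is regular (★ `isRegularElt_glDiagonal_of_isUnit_sub`), and a regular element of `M` is
  in `Ω`, so not in `G^e` (★ S2 `splitNotEll`);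
* §1 (C2) `ellCartanAE_of_null` — REDUCED to the two per-torus inputs of the PLAN (N2 «CARTAN-NULL»: `T ∖ T^{reg}` is `μT`-null, and «regular elements of a compact
  Cartan subgroup avoid `Ω`»); §3 `not_isCompact_cmTorus` — `M ≅ E_vˣ × E¹_v` is not compact (uniformiser powers, ★ `exists_uniformizer_units`, continuity of `|·|_w`);
  §4 «ELL-CARTAN-AVOIDS-Ω» `not_mem_hyperbolicSet_of_isCompact_centralizer` — a regular element of a COMPACT Cartan subgroup `Z(γ₀)` is not in `Ω` (`Z(t) = Z(γ₀)`,
  `Z(m) = M` ★ `centralizer_eq_cmTorus_of_isRegularElt`, so `M ⊆ x⁻¹Z(γ₀)x` would be compact), whence (C2) `ellCartanAE_of_compact_centralizers` modulo «CARTAN-NULL» only.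
HONEST LABEL: HC_CM is proved only modulo the 7 printed citations (2 remaining named inputs: hLiu418 = `stmt-HodgeConjecture-24832`, h413 = `stmt-HodgeConjecture-24833`)
until rung 0 closes; this file closes no organ — (C1)(C3) become in-house theorems at the future concrete datum, (C2) modulo its two named inputs (count-neutral).

## References
* [Rogawski1990] J. D. Rogawski, *Automorphic Representations of Unitary Groups in Three Variables*, Ann. of Math. Stud. 123 (1990): §3.6 pp. 28–31 (Cartan subgroups
  of `U(3)`); §12.5 p. 182 (Weyl integration formula, representatives of conjugacy classes of Cartan subgroups), p. 184 (`G^e`, elliptic representatives).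
* [HarishChandra1970] Harish-Chandra (notes by G. van Dijk), *Harmonic Analysis on Reductive p-adic Groups*, LNM 162 (1970), Lemma 42 (the singular set is null).
-/

set_option autoImplicit false
-- the mandated namespace has the single-problem summit's repeated segment (`HodgeConjecture.HodgeConjecture`)
set_option linter.dupNamespace false

noncomputable section

open NumberField IsDedekindDomain MeasureTheory Filter Topology
open scoped NNReal
open scoped Matrix MatrixGroups
open Literature.NumberTheory.Rogawski1990 Literature.NumberTheory.Automorphic Literature.NumberTheory.Automorphic.UnitaryGroup
open Literature.NumberTheory.GaloisRepresentations Literature.NumberTheory.GaloisRepresentations.IsNonarchimedeanLocalField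
open Literature.NumberTheory.Rogawski1990.Ch12Sec5
open Summit.HodgeConjecture.HodgeConjecture.Cruxes.H413.F0P3cStCharTSTorusDefs

namespace Summit.HodgeConjecture.HodgeConjecture.Cruxes.H413.F0P3cStCharTSCartanFields

/-! ## §1 (C1): the elliptic representatives filtered out of all representatives -/

section Generic

variable {G H' : Type} [Group G] [TopologicalSpace G] [IsTopologicalGroup G] [MeasurableSpace G]
  [∀ γ : G, MeasurableSpace (G ⧸ Subgroup.centralizer ({γ} : Set G))] [MeasurableSpace (G ⧸ Subgroup.center G)]
  [Group H'] [TopologicalSpace H'] [IsTopologicalGroup H'] [MeasurableSpace H']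

/-- **(C1) `EllCartanSubset`** at any datum whose elliptic representatives are the representatives FILTERED by some predicate (the constructor's
`cartanG := cartanAll.filter IsCompact`). [cite: Rogawski1990, §12.5 pp. 182, 184] -/
theorem ellCartanSubset_of_filter (𝔇 : EllipticData G H') (p : Subgroup G → Prop) [DecidablePred p]
    (h : 𝔇.cartanG = 𝔇.cartanAll.filter p) : 𝔇.EllCartanSubset := by
  rw [EllipticData.EllCartanSubset, h]
  exact Finset.filter_subset _ _

/-- **(C1)**, union form: `cartanAll = insert M cartanG` ⇒ `EllCartanSubset`. [cite: Rogawski1990, §12.5 pp. 182, 184] -/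
theorem ellCartanSubset_of_eq_insert (𝔇 : EllipticData G H') [DecidableEq (Subgroup G)] (M : Subgroup G)
    (h : 𝔇.cartanAll = insert M 𝔇.cartanG) : 𝔇.EllCartanSubset := by
  rw [EllipticData.EllCartanSubset, h]
  exact Finset.subset_insert _ _

/-- **(C2) `EllCartanAE` REDUCED to its two per-torus inputs**: if on every elliptic representative `T` (i) `μT`-a.e. `t` is regular («CARTAN-NULL», the singular
set of a torus is Haar-null) and (ii) every regular `t ∈ T` lies in `G^e` («regular elements of a compact Cartan subgroup avoid `Ω`»), then (C2).
[cite: Rogawski1990, §12.5 p. 184] [cite: HarishChandra1970, Lemma 42] -/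
theorem ellCartanAE_of_null (𝔇 : EllipticData G H') (P : G → Prop)
    (hnull : ∀ T ∈ 𝔇.cartanG, ∀ᵐ t : ↥T ∂(𝔇.μT T), P (t : G))
    (havoid : ∀ T ∈ 𝔇.cartanG, ∀ t : ↥T, P (t : G) → (t : G) ∈ 𝔇.ellG) : 𝔇.EllCartanAE := by
  intro T hT
  filter_upwards [hnull T hT] with t ht
  exact havoid T hT t ht

end Generic

/-! ## §2 (C3): the split torus `M` is the only non-elliptic representative -/

section U3

variable (L : Type) [Field L] [NumberField L] [IsCMField L] (v : HeightOneSpectrum (𝓞 ↥(maximalRealSubfield L)))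

/-- **Haar-a.e. `t ∈ M` is regular** (pairwise unit differences of the diagonal entries, ★ `ae_isUnit_torusEntry_sub_three`, make `∏ (X − dᵢ)` separable, ★
`isRegularElt_glDiagonal_of_isUnit_sub`). [cite: Rogawski1990, §12.5 p. 182] [cite: HarishChandra1970, Lemma 42] -/
theorem ae_isRegularElt_cmTorus
    [MeasurableSpace ↥(unitaryGroupOfForm (conjLocal L (IsCMField.complexConj L) v) (cmLocalForm L 3 v))]
    [BorelSpace ↥(unitaryGroupOfForm (conjLocal L (IsCMField.complexConj L) v) (cmLocalForm L 3 v))]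
    (μT : Measure ↥(cmBorelTriple L 3 v).M) (hμT : μT.IsHaarMeasure) :
    ∀ᵐ t : ↥(cmBorelTriple L 3 v).M ∂μT,
      IsRegularElt (((t : ↥(unitaryGroupOfForm (conjLocal L (IsCMField.complexConj L) v) (cmLocalForm L 3 v))) : GL (Fin 3) (UnitaryGroup.LocalRing L v))) := by
  haveI := hμT
  filter_upwards [ae_isUnit_torusEntry_sub_three L v μT] with t ht
  obtain ⟨d, hd⟩ := (mem_torusU_iff _).1 t.2
  have hdi : ∀ i, torusEntry (conjLocal L (IsCMField.complexConj L) v) (cmLocalForm L 3 v) i t = d i :=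
    fun i => torusEntry_eq_of_glDiagonal_eq _ _ i t d hd
  rw [← hd]
  exact F0P3cStCharTSWeylHypMeasure.isRegularElt_glDiagonal_of_isUnit_sub fun i j hij => by
    rw [← hdi, ← hdi]; exact ht.1 i j hij

/-- **(C3) `NonEllCartanAE` AT THE SPLIT REPRESENTATIVE** (`v` any finite place): at a datum on `(U(Φ₃)(L⁺_v), H)` whose regular set is the organ's (COMPAT), whose
`ellG` is `G^r ∖ Ω` (★ S2), whose ONLY non-elliptic Cartan representative is the diagonal torus `M` and whose `μT M` is a Haar measure on `M`, the socket (C3) HOLDS: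
`μT`-a.e. `t ∈ M` is regular (§2) and a regular element of `M` is not in `G^e` (★ S2 `splitNotEll`). [cite: Rogawski1990, §12.5 pp. 182, 184; §3.6] -/
theorem nonEllCartanAE_of_split
    [MeasurableSpace (Gqs L v)] [BorelSpace (Gqs L v)]
    [∀ γ : Gqs L v, MeasurableSpace (Gqs L v ⧸ Subgroup.centralizer ({γ} : Set (Gqs L v)))]
    [MeasurableSpace (Gqs L v ⧸ Subgroup.center (Gqs L v))]
    {H' : Type} [Group H'] [TopologicalSpace H'] [IsTopologicalGroup H'] [MeasurableSpace H']
    (𝔇 : EllipticData (Gqs L v) H')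
    (hR : ∀ γ : Gqs L v, γ ∈ 𝔇.regG ↔ IsRegularElt (γ.val : GL (Fin 3) (UnitaryGroup.LocalRing L v)))
    (hE : ∀ γ : Gqs L v, γ ∈ 𝔇.ellG ↔ IsRegularElt (γ.val : GL (Fin 3) (UnitaryGroup.LocalRing L v)) ∧ γ ∉ hyperbolicSet L v)
    (hM : ∀ T ∈ 𝔇.cartanAll, T ∉ 𝔇.cartanG → T = (cmBorelTriple L 3 v).M)
    (hHaar : (𝔇.μT (cmBorelTriple L 3 v).M).IsHaarMeasure) :
    𝔇.NonEllCartanAE := by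
  -- the organ's measurable structure on `Gqs L v`, re-read on the matrix carrier (so `M` inherits it)
  letI hmsU : MeasurableSpace ↥(unitaryGroupOfForm (conjLocal L (IsCMField.complexConj L) v) (cmLocalForm L 3 v)) := ‹MeasurableSpace (Gqs L v)›
  haveI : BorelSpace ↥(unitaryGroupOfForm (conjLocal L (IsCMField.complexConj L) v) (cmLocalForm L 3 v)) := ⟨BorelSpace.measurable_eq (α := Gqs L v)⟩
  intro T hT hTn
  obtain rfl := hM T hT hTn
  filter_upwards [ae_isRegularElt_cmTorus L v (𝔇.μT (cmBorelTriple L 3 v).M) hHaar] with t ht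
  exact ⟨(hR _).2 ht, F0P3cStCharTSEllField.splitNotEll L v 𝔇 hE t ht⟩

/-! ## §3 The split torus `M ≅ E_vˣ × E¹_v` is NOT compact -/

/-- **`M` is not compact** (`E_vˣ` is unbounded: the powers `ϖ⁻ⁿ` of a uniformiser have `|·|_w → ∞`, and `t ↦ |t₀₀|_w` is continuous on `M`).
[cite: Rogawski1990, §12.2 p. 173; §3.6] [cite: WeilBNT1967, Ch. I §4] -/
theorem not_isCompact_cmTorus :
    ¬ IsCompact (((cmBorelTriple L 3 v).M : Subgroup ↥(unitaryGroupOfForm (conjLocal L (IsCMField.complexConj L) v) (cmLocalForm L 3 v))) :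
      Set ↥(unitaryGroupOfForm (conjLocal L (IsCMField.complexConj L) v) (cmLocalForm L 3 v))) := by
  intro hK
  obtain ⟨w⟩ := (inferInstance : Nonempty (PlacesOver L v))
  obtain ⟨ϖ, hϖ⟩ := F0P3cStCharTSTorusRay.exists_uniformizer_units L v
  -- the continuous size function `t ↦ |d₀(t)_w|_w` on `M`
  set f : ↥(cmBorelTriple L 3 v).M → ℝ≥0 := fun t =>
    normAbs (w.1.adicCompletion L) (((torusEntry (conjLocal L (IsCMField.complexConj L) v) (cmLocalForm L 3 v) 0 t : (LocalRing L v)ˣ) : LocalRing L v) w)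
    with hf
  have hfc : Continuous f :=
    LocalFieldHaar.continuous_normAbs.comp ((continuous_apply w).comp (continuous_coe_torusEntry_apply _ _ 0))
  haveI : CompactSpace ↥(cmBorelTriple L 3 v).M := isCompact_iff_compactSpace.1 hK
  obtain ⟨B, hB⟩ := (isCompact_range hfc).bddAbove
  -- the value at `ι(ϖ⁻ⁿ, 1)` is `|ϖ_w|_w⁻ⁿ`, unbounded
  have hq1 : normAbs (w.1.adicCompletion L) ((ϖ : LocalRing L v) w) < 1 := by
    rw [← map_one (normAbs (w.1.adicCompletion L)), ← not_le, normAbs_le_normAbs_iff_valued, map_one, hϖ w, not_le, ← WithZero.exp_zero]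
    exact WithZero.exp_lt_exp.2 (by norm_num)
  have hq0 : normAbs (w.1.adicCompletion L) ((ϖ : LocalRing L v) w) ≠ 0 := by
    rw [map_ne_zero]
    intro h0
    have h := hϖ w
    rw [h0, map_zero] at h
    exact WithZero.zero_ne_coe h
  set q := normAbs (w.1.adicCompletion L) ((ϖ : LocalRing L v) w) with hq
  -- `|ϖ⁻¹_w|_w = q⁻¹`
  have hinv : normAbs (w.1.adicCompletion L) (((ϖ⁻¹ : (LocalRing L v)ˣ) : LocalRing L v) w) = q⁻¹ := by
    refine eq_inv_of_mul_eq_one_left ?_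
    rw [← map_mul, ← Pi.mul_apply, ← Units.val_mul, inv_mul_cancel, Units.val_one, Pi.one_apply, map_one]
  have hval : ∀ n : ℕ, f (torusChart L v (ϖ⁻¹ ^ n, 1)) = q⁻¹ ^ n := by
    intro n
    have h0 : torusEntry (conjLocal L (IsCMField.complexConj L) v) (cmLocalForm L 3 v) 0 (torusChart L v (ϖ⁻¹ ^ n, 1)) = ϖ⁻¹ ^ n :=
      torusEntry_eq_of_glDiagonal_eq _ _ 0 _ _ (coe_torusChart L v (ϖ⁻¹ ^ n, 1)).symm
    rw [hf]
    simp only [h0, Units.val_pow_eq_pow_val, Pi.pow_apply, map_pow, hinv]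
  have hlt : 1 < q⁻¹ := one_lt_inv_iff₀.2 ⟨pos_iff_ne_zero.2 hq0, hq1⟩
  obtain ⟨n, hn⟩ := (tendsto_pow_atTop_atTop_of_one_lt hlt).eventually_gt_atTop B |>.exists
  have hle : q⁻¹ ^ n ≤ B := by
    rw [← hval n]
    exact hB ⟨_, rfl⟩
  exact (not_lt.2 hle) hn

/-! ## §4 «ELL-CARTAN-AVOIDS-Ω»: the regular elements of a COMPACT Cartan subgroup are not in `Ω`; hence (C2) at compact-centraliser representatives -/

/-- Equality in `U(Φ₃)(L⁺_v)` from commuting matrices and conversely. [cite: Rogawski1990, §3.1 p. 19] -/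
theorem mul_eq_mul_iff_commute (a b : ↥(unitaryGroupOfForm (conjLocal L (IsCMField.complexConj L) v) (cmLocalForm L 3 v))) :
    a * b = b * a ↔ Commute (a.val.val : Matrix (Fin 3) (Fin 3) (LocalRing L v)) (b.val.val : Matrix (Fin 3) (Fin 3) (LocalRing L v)) := by
  constructor
  · intro h
    have h' := congrArg (fun g : ↥(unitaryGroupOfForm (conjLocal L (IsCMField.complexConj L) v) (cmLocalForm L 3 v)) =>
      (g.val.val : Matrix (Fin 3) (Fin 3) (LocalRing L v))) h
    simp only [Subgroup.coe_mul, Units.val_mul] at h'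
    exact h'
  · intro h
    apply Subtype.ext
    apply Units.ext
    simpa only [Subgroup.coe_mul, Units.val_mul] using h.eq

/-- **The centraliser of a regular element of a Cartan subgroup `Z(γ₀)` (`γ₀` regular) IS `Z(γ₀)`** (both centralisers are abelian, ★ `commute_of_commute_of_isRegularElt_local`).
[cite: Rogawski1990, §3.1 p. 19; §3.6 p. 28] -/
theorem centralizer_eq_of_mem_centralizer {γ₀ t : ↥(unitaryGroupOfForm (conjLocal L (IsCMField.complexConj L) v) (cmLocalForm L 3 v))}
    (hγ₀ : IsRegularElt (γ₀ : GL (Fin 3) (LocalRing L v)))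
    (ht : t ∈ Subgroup.centralizer ({γ₀} : Set ↥(unitaryGroupOfForm (conjLocal L (IsCMField.complexConj L) v) (cmLocalForm L 3 v))))
    (htreg : IsRegularElt (t : GL (Fin 3) (LocalRing L v))) :
    Subgroup.centralizer ({t} : Set ↥(unitaryGroupOfForm (conjLocal L (IsCMField.complexConj L) v) (cmLocalForm L 3 v))) =
      Subgroup.centralizer ({γ₀} : Set ↥(unitaryGroupOfForm (conjLocal L (IsCMField.complexConj L) v) (cmLocalForm L 3 v))) := by
  rw [Subgroup.mem_centralizer_singleton_iff] at ht
  have htc := (mul_eq_mul_iff_commute L v t γ₀).1 ht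
  ext x
  rw [Subgroup.mem_centralizer_singleton_iff, Subgroup.mem_centralizer_singleton_iff, mul_eq_mul_iff_commute, mul_eq_mul_iff_commute]
  constructor
  · intro hx
    exact commute_of_commute_of_isRegularElt_local L v (t : Gqs L v) htreg _ _ hx htc.symm
  · intro hx
    exact commute_of_commute_of_isRegularElt_local L v (γ₀ : Gqs L v) hγ₀ _ _ hx htc

set_option maxHeartbeats 400000 in
/-- **«ELL-CARTAN-AVOIDS-Ω»: a regular element `t` of a COMPACT Cartan subgroup `T = Z(γ₀)` (`γ₀` regular) is not in `Ω`.**  If `t = x m x⁻¹` with `m ∈ M` regular, then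
`Z(m) = M` (★ `centralizer_eq_cmTorus_of_isRegularElt`) and `Z(t) = T` (§4), so `M ⊆ x⁻¹ T x` would be compact — but `M` is not (§3). [cite: Rogawski1990, §12.5 p. 184; §3.6] -/
theorem not_mem_hyperbolicSet_of_isCompact_centralizer {γ₀ : ↥(unitaryGroupOfForm (conjLocal L (IsCMField.complexConj L) v) (cmLocalForm L 3 v))}
    (hγ₀ : IsRegularElt (γ₀ : GL (Fin 3) (LocalRing L v)))
    (hcpt : IsCompact ((Subgroup.centralizer ({γ₀} : Set ↥(unitaryGroupOfForm (conjLocal L (IsCMField.complexConj L) v) (cmLocalForm L 3 v)))) :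
      Set ↥(unitaryGroupOfForm (conjLocal L (IsCMField.complexConj L) v) (cmLocalForm L 3 v))))
    {t : ↥(unitaryGroupOfForm (conjLocal L (IsCMField.complexConj L) v) (cmLocalForm L 3 v))}
    (ht : t ∈ Subgroup.centralizer ({γ₀} : Set ↥(unitaryGroupOfForm (conjLocal L (IsCMField.complexConj L) v) (cmLocalForm L 3 v))))
    (htreg : IsRegularElt (t : GL (Fin 3) (LocalRing L v))) :
    (t : Gqs L v) ∉ hyperbolicSet L v := by
  rintro ⟨m, hmreg, hconj⟩
  obtain ⟨x, hx⟩ := isConj_iff.1 hconj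
  -- read the conjugator in the subtype group `U(Φ₃)(L⁺_v)` (the carrier of `Gqs L v`, definitionally)
  let x' : ↥(unitaryGroupOfForm (conjLocal L (IsCMField.complexConj L) v) (cmLocalForm L 3 v)) := x
  have hx' : x' * (m : ↥(unitaryGroupOfForm (conjLocal L (IsCMField.complexConj L) v) (cmLocalForm L 3 v))) * x'⁻¹ = t := hx
  have hZm := F0P3cStCharTSWeylHypCM.centralizer_eq_cmTorus_of_isRegularElt L v m.2 hmreg
  have hZt := centralizer_eq_of_mem_centralizer L v hγ₀ ht htreg
  set c : ↥(unitaryGroupOfForm (conjLocal L (IsCMField.complexConj L) v) (cmLocalForm L 3 v)) →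
      ↥(unitaryGroupOfForm (conjLocal L (IsCMField.complexConj L) v) (cmLocalForm L 3 v)) := fun g => x'⁻¹ * g * x' with hc
  have hcc : Continuous c := (continuous_const.mul continuous_id).mul continuous_const
  -- `M ⊆ x⁻¹ Z(γ₀) x`
  have hsub : (((cmBorelTriple L 3 v).M : Subgroup ↥(unitaryGroupOfForm (conjLocal L (IsCMField.complexConj L) v) (cmLocalForm L 3 v))) :
      Set ↥(unitaryGroupOfForm (conjLocal L (IsCMField.complexConj L) v) (cmLocalForm L 3 v))) ⊆
      c '' ((Subgroup.centralizer ({γ₀} : Set ↥(unitaryGroupOfForm (conjLocal L (IsCMField.complexConj L) v) (cmLocalForm L 3 v)))) :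
        Set ↥(unitaryGroupOfForm (conjLocal L (IsCMField.complexConj L) v) (cmLocalForm L 3 v))) := by
    intro m' hm'
    rw [← hZm, SetLike.mem_coe, Subgroup.mem_centralizer_singleton_iff] at hm'
    refine ⟨x' * m' * x'⁻¹, ?_, ?_⟩
    · rw [SetLike.mem_coe, ← hZt, Subgroup.mem_centralizer_singleton_iff, ← hx']
      have h1 : x' * m' * x'⁻¹ * (x' * ↑m * x'⁻¹) = x' * (m' * ↑m) * x'⁻¹ := by group
      have h2 : x' * ↑m * x'⁻¹ * (x' * m' * x'⁻¹) = x' * (↑m * m') * x'⁻¹ := by group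
      rw [h1, h2, hm']
    · rw [hc]
      group
  have hcpt' := (hcpt.image hcc).of_isClosed_subset (isClosed_torusU_of_t1Space (conjLocal L (IsCMField.complexConj L) v) (cmLocalForm L 3 v)) hsub
  exact not_isCompact_cmTorus L v hcpt'

/-- **(C2) `EllCartanAE` AT COMPACT-CENTRALISER REPRESENTATIVES, modulo «CARTAN-NULL»**: at a datum on `(U(Φ₃)(L⁺_v), H)` whose `ellG` is `G^r ∖ Ω` and whose elliptic
representatives are COMPACT centralisers of regular elements (print's elliptic Cartan subgroups, the centre being compact), (C2) holds as soon as the singular set of each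
representative is `μT`-null. [cite: Rogawski1990, §12.5 p. 184; §3.6] [cite: HarishChandra1970, Lemma 42] -/
theorem ellCartanAE_of_compact_centralizers
    [MeasurableSpace (Gqs L v)]
    [∀ γ : Gqs L v, MeasurableSpace (Gqs L v ⧸ Subgroup.centralizer ({γ} : Set (Gqs L v)))]
    [MeasurableSpace (Gqs L v ⧸ Subgroup.center (Gqs L v))]
    {H' : Type} [Group H'] [TopologicalSpace H'] [IsTopologicalGroup H'] [MeasurableSpace H']
    (𝔇 : EllipticData (Gqs L v) H')
    (hE : ∀ γ : Gqs L v, γ ∈ 𝔇.ellG ↔ IsRegularElt (γ.val : GL (Fin 3) (UnitaryGroup.LocalRing L v)) ∧ γ ∉ hyperbolicSet L v)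
    (hcart : ∀ T ∈ 𝔇.cartanG, IsCompact (T : Set (Gqs L v)) ∧
      ∃ γ₀ : Gqs L v, IsRegularElt (γ₀.val : GL (Fin 3) (UnitaryGroup.LocalRing L v)) ∧ T = Subgroup.centralizer ({γ₀} : Set (Gqs L v)))
    (hnull : ∀ T ∈ 𝔇.cartanG, ∀ᵐ t : ↥T ∂(𝔇.μT T), IsRegularElt ((t : Gqs L v).val : GL (Fin 3) (UnitaryGroup.LocalRing L v))) :
    𝔇.EllCartanAE := by
  refine ellCartanAE_of_null 𝔇 (fun γ : Gqs L v => IsRegularElt (γ.val : GL (Fin 3) (UnitaryGroup.LocalRing L v))) hnull fun T hT t ht => ?_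
  obtain ⟨hTc, γ₀, hγ₀, rfl⟩ := hcart T hT
  refine (hE _).2 ⟨ht, ?_⟩
  exact not_mem_hyperbolicSet_of_isCompact_centralizer L v
    (γ₀ := (γ₀ : ↥(unitaryGroupOfForm (conjLocal L (IsCMField.complexConj L) v) (cmLocalForm L 3 v)))) hγ₀ hTc
    (t := ((t : Gqs L v) : ↥(unitaryGroupOfForm (conjLocal L (IsCMField.complexConj L) v) (cmLocalForm L 3 v)))) t.2 ht

end U3

end Summit.HodgeConjecture.HodgeConjecture.Cruxes.H413.F0P3cStCharTSCartanFields

end
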